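import Mathlib
import Summits.Ventures.PercRepro2.LocRows
import Summits.Ventures.PercRepro2.SwRow
import Summits.Ventures.PercRepro2.SwOut
import Summits.Ventures.PercRepro2.SwAllRow
import Summits.Ventures.PercRepro2.SwOutAll
import Summits.Ventures.PercRepro2.SwOutArmFlip
import Summits.Ventures.PercRepro2.SwOutArms
import Summits.Ventures.PercRepro2.SwOutArmOrbit
import Summits.Ventures.PercRepro2.SwOutArmCube
import Summits.Ventures.PercRepro2.SwOutArmThm
import Summits.Ventures.PercRepro2.SwOutCoreDefs
import Summits.Ventures.PercRepro2.SwOutCoreCube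
import Summits.Ventures.PercRepro2.SwOutCoreDual
import Summits.Ventures.PercRepro2.SwOutCoreKey
import Summits.Ventures.PercRepro2.SwOutCoreShadowKey
import Summits.Ventures.PercRepro2.SwOutCoreShadowOrbit
import Summits.Ventures.PercRepro2.SwOutBlocks
import Summits.Ventures.PercRepro2.SwOutReducible
import Summits.Ventures.PercRepro2.SwOutJunctionH1Defs
import Summits.Ventures.PercRepro2.SwOutJunctionH1Arms
import Summits.Ventures.PercRepro2.SwOutJunctionH1Base
import Summits.Ventures.PercRepro2.SwOutJunctionH1Kinds
import Summits.Ventures.PercRepro2.SwOutJunctionH1Orbit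
import Summits.Ventures.PercRepro2.SwOutBigBlockDefs
import Summits.Ventures.PercRepro2.SwOutMixedBaseDefs
import Summits.Ventures.PercRepro2.SwOutMixedCore
import Summits.Ventures.PercRepro2.SwOutMixedCoreEdgeMap
import Summits.Ventures.PercRepro2.SwOutMixedCoreClassIff
import Summits.Ventures.PercRepro2.SwOutMixedCoreBlockThm
import Summits.Ventures.PercRepro2.SwOutMixedPartDefs
import Summits.Ventures.PercRepro2.SwOutMixedPartBase
import Summits.Ventures.PercRepro2.SwOutMixedPartCore
import Summits.Ventures.PercRepro2.SwOutMixedPartCoreKey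
import Summits.Ventures.PercRepro2.SwOutMixedPartKey
import Summits.Ventures.PercRepro2.SwOutMixedPartOrbitDefs
import Summits.Ventures.PercRepro2.SwOutMixedPartOrbit
import Summits.Ventures.PercRepro2.SwOutMixedPartArmsUnion
import Summits.Ventures.PercRepro2.SwOutMixedPartEsc
import Summits.Ventures.PercRepro2.SwOutMixedPartBaseE
import Summits.Ventures.PercRepro2.SwOutMixedPartRed
import Summits.Ventures.PercRepro2.SwOutMixedPartClass
import Summits.Ventures.PercRepro2.SwOutMixedPartKeyDefs
import Summits.Ventures.PercRepro2.SwOutMixedPartBlocks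

/-!
# THEOREM A_mix: the rigid inequality on every mixed single-junction class (blind cell
PercRepro2, night-4 g19, 2026-08-27; proofs/NIGHT4-G19.md §6)

A single-junction base region `U ∋ h` (`l ∉ U`) with a MIXED SINGLE JUNCTION at `(u, p)`
(`MixedJunction`: `u` the junction, `p` its dropped vertex with its h-piece — the simple-arm
hypothesis (H1) of Theorem A fails at `p`), the mark `o` outside the component of `p`, and the
h-piece connected at every core-kind point (`AhConn`, e.g. when `p` has a single partner inside
the region).  THE KEY of a `Q`-point (`keyM`) and THE BLOCKS (`blockM`): the coarse orbit of an
out point or of an escaping point of the plain kind, the core cube of a core-kind point with a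
red dead edge (Theorem A's core kind, `coreBase_of_coreKind_mix`), the MIXED BLOCK `blockC` of
the canonical base of a core-kind point with blue dead edges (`mixedBase_of_coreKind`) — which
also owns the escaping points of the mixed kind (`MixedKindE`).  Every `Q`-point lies in the
block of its key (`mem_blockM_keyM`), every `Q`-point of that block lies in the class with the
same key (`keyM_eq_of_mem_blockM`: the constancy along a mixed block is
`keyM_eq_of_mem_mixedBlock`; along a plain orbit no core-kind point can appear — a core-kind
point with a red dead edge absorbs its orbit, `coreKind_of_mem_orbit_red`, and one with blue
dead edges would make the orbit's escaping points of the mixed kind), and every block satisfies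
the rigid inequality (`card_blockM_le`: `card_orbit_le`, `card_coreCube_le`, `card_mixedBlock_le`
= `rigid_block`); `rigidOK_of_blocks` assembles them: **`rigidOK_of_mixedJunction`**.
-/

namespace Summit.Ventures.PercRepro2

namespace BigBlock

open Hull LocRows

variable {V : Type*} {E : Type*} [Fintype E] [DecidableEq E]

open scoped Classical

variable {ends : E → Sym2 V} {U : Set V} {ξ : Config E} {l h o u p : V}

variable (hj : MixedJunction ends U h u p o) (hl : l ∉ U) (ho : o ∉ compU ends U h u p)
  (hAh : AhConn ends U ξ l h o u p)
include hj hl ho hAh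

omit ho hAh in
/-- Every `Q`-point lies in the block of its key. -/
theorem mem_blockM_keyM {ζ : Config E} (hζ : ζ ∈ swOutSide ends l h o U ξ) :
    ζ ∈ blockM ends h u p (keyM ends U ξ l h o u p ζ) := by
  by_cases hu : u ∉ hull ends ζ h
  · rw [keyM_of_out hu]
    exact (orbitKind_block hl hj.hloop_h hj.hout hζ hu).1
  rw [not_not] at hu
  by_cases hk : hull ends ζ u ⊆ U
  · by_cases hd : DeadBlue ends h u p ζ
    · rw [keyM_of_coreMixed hu hk hd]
      refine mem_mixedBlock.2 ⟨qOf ends h u p ζ, ?_, mixedReal_coreBaseOf hj hl hζ ⟨hu, hk⟩⟩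
      exact (not_leak'_iff _).2 (Or.inl ⟨rfl, rfl⟩)
    · rw [keyM_of_coreRed hu hk hd]
      exact (mem_coreCube).2 ⟨omegaOf ends h u ζ, coreReal_coreBaseOf hl hj.hne_hu hj.hout hζ ⟨hu, hk⟩⟩
  by_cases hm : MixedKindE ends U ξ l h o u p ζ
  · rw [keyM_of_escMixed hu hk hm]
    obtain ⟨ζ₀, _, _, _, hdata, hmem⟩ := hm
    show ζ ∈ mixedBlock ends u p (mixedData ends h u p (baseE ends h u p ζ))
    rw [← hdata]
    exact hmem
  · rw [keyM_of_plain hu hk hm]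
    have hc : CoreFree ends ζ h := coreFree_of_escaping hj.hout hζ hk
    obtain ⟨ω, hω⟩ := exists_orbitReal_eq (ζ₀ := allRed ends ζ h) hc rfl
    simp only [blockM, orbit, Finset.mem_image, Finset.mem_univ, true_and]
    exact ⟨ω, hω⟩

/-- An escaping `Q`-point in the coarse orbit of a core-kind `Q`-point is of the mixed kind. -/
theorem mixedKindE_of_mem_orbit_coreKind {ζ' : Config E} (hζ' : ζ' ∈ swOutSide ends l h o U ξ)
    (hk' : CoreKind ends U h u ζ') (hc' : CoreFree ends ζ' h) {ζ : Config E}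
    (hζ : ζ ∈ swOutSide ends l h o U ξ) (hesc : ¬ hull ends ζ u ⊆ U)
    (hζorb : ζ ∈ orbit ends (allRed ends ζ' h) h) : MixedKindE ends U ξ l h o u p ζ := by
  by_cases hd : DeadBlue ends h u p ζ'
  · -- blue dead edges: the orbit stays in the mixed block, and `ζ` is an escaping point of it
    have hb := mixedBase_of_coreKind hj hl hζ' hk' hd
    haveI : Nonempty (uArms ends h u p ζ') := uArms_nonempty_of_coreKind hj hl hζ' hk' hd
    have hq : Core (qOf ends h u p ζ') := ⟨rfl, rfl⟩
    have hζeq := mixedReal_coreBaseOf hj hl hζ' hk'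
    rw [← hζeq] at hc' hζorb
    obtain ⟨q', hq'⟩ := hb.exists_mixedReal_of_mem_orbit hj.hup (exists_dead_edge hj ζ')
      (uArms_conn ζ') (hAh ζ' hζ' hk') (farArms_conn ζ') (not_leakR_of_core hq)
      (not_leakB_of_core hq) hc' hζorb
    obtain ⟨ed, y, hey, hyA⟩ := exists_dead_edge hj ζ'
    have hcl := (mem_swOutSide.1 hζ).2
    rw [hq'] at hcl
    have hq'nl : ¬ Leak' q' := (hb.mem_outClass_iff hj.hup (arms_subset_of_coreKind hj hζ' hk')
      (coreBaseOf_agree hζ' hk') (exists_ext_edge hj hζ' hk') (ext_out hj hζ' hk')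
      ⟨ed, y, hey, hyA⟩ (Ah_bdry hj ho hζ' hk') q').1 hcl
    have hq'RB := hq'nl
    rw [leak'_iff, not_or] at hq'RB
    rcases (not_leak'_iff q').1 hq'nl with hC | hE
    · exfalso
      have := coreKind_mixedReal_core hj hl hζ' hk' hd hC
      rw [← hq'] at this
      exact hesc this.2
    · refine ⟨ζ', hζ', hk', hd, ?_, ?_⟩
      · rw [hq', hb.baseE_esc hj.hup ⟨ed, y, hey, hyA⟩ (uArms_conn ζ') (hAh ζ' hζ' hk')
          (farArms_conn ζ') hq'RB.1 hq'RB.2 hE, mixedData_coreBaseOf hj hl hζ' hk' hd]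
      · exact mem_mixedBlock.2 ⟨q', hq'nl, hq'.symm⟩
  · -- a red dead edge: the orbit consists of core-kind points
    exfalso
    exact hesc (coreKind_of_mem_orbit_red hj hl hζ' hk' (exists_red_dead_of_not_deadBlue hd) hc'
      hζorb).2

/-- **Every `Q`-point of the block of a `Q`-point lies in the class with the same key.** -/
theorem keyM_eq_of_mem_blockM {ζ : Config E} (hζ : ζ ∈ swOutSide ends l h o U ξ) {ζ' : Config E}
    (hζ' : ζ' ∈ blockM ends h u p (keyM ends U ξ l h o u p ζ))
    (hQ : ζ' ∈ tgtU ends l h {T : Set V | o ∈ T}) :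
    ζ' ∈ swOutSide ends l h o U ξ ∧ keyM ends U ξ l h o u p ζ' = keyM ends U ξ l h o u p ζ := by
  by_cases hu : u ∉ hull ends ζ h
  · rw [keyM_of_out hu] at hζ' ⊢
    obtain ⟨h1, h2, h3⟩ := (orbitKind_block hl hj.hloop_h hj.hout hζ hu).2.1 ζ' hζ' hQ
    exact ⟨h1, by rw [keyM_of_out h2, h3]⟩
  rw [not_not] at hu
  by_cases hk : hull ends ζ u ⊆ U
  · by_cases hd : DeadBlue ends h u p ζ
    · rw [keyM_of_coreMixed hu hk hd] at hζ' ⊢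
      exact keyM_eq_of_mem_mixedBlock hj hl ho hAh hζ ⟨hu, hk⟩ hd hζ' hQ
    · rw [keyM_of_coreRed hu hk hd] at hζ' ⊢
      have hb := coreBase_of_coreKind_mix hj hl hζ ⟨hu, hk⟩ (exists_red_dead_of_not_deadBlue hd)
      have hHU := extHull_subset_of_coreKind hζ ⟨hu, hk⟩
      obtain ⟨ω, rfl⟩ := (mem_coreCube).1 hζ'
      have hQ' : coreReal ends (fun P : armsC ends h u ζ => P.1) (coreBaseOf ends ζ h u) ω ∈
          tgtU ends l h {T : Set V | o ∈ T} := hQ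
      show coreReal ends (fun P : armsC ends h u ζ => P.1) (coreBaseOf ends ζ h u) ω ∈
          swOutSide ends l h o U ξ ∧
        keyM ends U ξ l h o u p (coreReal ends (fun P : armsC ends h u ζ => P.1)
          (coreBaseOf ends ζ h u) ω) = Sum.inr (Sum.inl (coreBaseOf ends ζ h u, armsC ends h u ζ))
      have hbcl := coreBaseOf_mem_outClass (mem_swOutSide.1 hζ).2 ⟨hu, hk⟩ hb
      refine ⟨mem_swOutSide.2 ⟨hQ', hb.coreReal_mem_outClass hHU hbcl ω⟩, ?_⟩
      have hE := hb.extHull_coreReal ω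
      have hdead' : ¬ DeadBlue ends h u p (coreReal ends (fun P : armsC ends h u ζ => P.1)
          (coreBaseOf ends ζ h u) ω) := by
        intro hd'
        apply hd
        intro e x hxe hx
        have := hd' e x hxe (by
          show x ∈ armC ends h u _ p \ {p}
          rw [armC_eq_of_extHull_eq hE]
          exact hx)
        rw [hb.coreBaseOf_coreReal] at this
        exact this
      rw [keyM_of_coreRed (hb.u_mem_hull_coreReal ω) ((hb.hull_u_coreReal_subset ω).trans hHU)
        hdead', hb.coreBaseOf_coreReal, armsC_eq_of_extHull_eq hE]
  by_cases hm : MixedKindE ends U ξ l h o u p ζ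
  · rw [keyM_of_escMixed hu hk hm] at hζ' ⊢
    obtain ⟨ζ₀, hζ₀, hk₀, hd₀, hdata, _⟩ := hm
    rw [← hdata] at hζ' ⊢
    exact keyM_eq_of_mem_mixedBlock hj hl ho hAh hζ₀ hk₀ hd₀ hζ' hQ
  · rw [keyM_of_plain hu hk hm] at hζ' ⊢
    have hc : CoreFree ends ζ h := coreFree_of_escaping hj.hout hζ hk
    have hc₀ : CoreFree ends (allRed ends ζ h) h := coreFree_allRed hc
    have hcl₀ : allRed ends ζ h ∈ outClass ends U h ξ :=
      allRed_mem_outClass (mem_swOutSide.1 hζ).2 hc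
    have hmem := hζ'
    simp only [blockM, orbit, Finset.mem_image, Finset.mem_univ, true_and] at hmem
    obtain ⟨ω', rfl⟩ := hmem
    have hζ'cl : orbitReal ends (allRed ends ζ h) h ω' ∈ swOutSide ends l h o U ξ :=
      mem_swOutSide.2 ⟨hQ, orbitReal_mem_outClass hc₀ hcl₀ ω'⟩
    have hu' : u ∈ hull ends (orbitReal ends (allRed ends ζ h) h ω') h := by
      rw [hull_orbitReal hc₀, hull_allRed hc]; exact hu
    have hc' : CoreFree ends (orbitReal ends (allRed ends ζ h) h ω') h := coreFree_orbitReal hc₀ ω'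
    have hall : allRed ends (orbitReal ends (allRed ends ζ h) h ω') h = allRed ends ζ h := by
      rw [allRed_orbitReal hc₀, allRed_idem hc]
    have hζorb : ζ ∈ orbit ends (allRed ends (orbitReal ends (allRed ends ζ h) h ω') h) h := by
      rw [hall]
      obtain ⟨ω, hω⟩ := exists_orbitReal_eq (ζ₀ := allRed ends ζ h) hc rfl
      simp only [orbit, Finset.mem_image, Finset.mem_univ, true_and]
      exact ⟨ω, hω⟩
    -- `ζ'` is escaping: a core-kind orbit point would make `ζ` of the mixed kind
    have hesc' : ¬ hull ends (orbitReal ends (allRed ends ζ h) h ω') u ⊆ U := fun hsub =>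
      hm (mixedKindE_of_mem_orbit_coreKind hj hl ho hAh hζ'cl ⟨hu', hsub⟩ hc' hζ hk hζorb)
    -- `ζ'` is not of the mixed kind: its block would contain `ζ`
    have hm' : ¬ MixedKindE ends U ξ l h o u p (orbitReal ends (allRed ends ζ h) h ω') := by
      rintro ⟨ζ₀, hζ₀, hk₀, hd₀, hdata, hmem⟩
      obtain ⟨q, hq, hqζ'⟩ := mem_mixedBlock.1 hmem
      have hb := mixedBase_of_coreKind hj hl hζ₀ hk₀ hd₀
      haveI : Nonempty (uArms ends h u p ζ₀) := uArms_nonempty_of_coreKind hj hl hζ₀ hk₀ hd₀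
      have hqRB := hq
      rw [leak'_iff, not_or] at hqRB
      have hcq : CoreFree ends (mixedReal ends u p (fun P : uArms ends h u p ζ₀ => P.1)
          (AhOf ends h u p ζ₀) (fun P : farArms ends h u p ζ₀ => P.1) (coreBaseOf ends ζ₀ h u) q) h :=
        by rw [hqζ']; exact hc'
      have hζorb' := hζorb
      rw [← hqζ'] at hζorb'
      obtain ⟨q', hq'⟩ := hb.exists_mixedReal_of_mem_orbit hj.hup (exists_dead_edge hj ζ₀)
        (uArms_conn ζ₀) (hAh ζ₀ hζ₀ hk₀) (farArms_conn ζ₀) hqRB.1 hqRB.2 hcq hζorb'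
      obtain ⟨ed, y, hey, hyA⟩ := exists_dead_edge hj ζ₀
      have hcl := (mem_swOutSide.1 hζ).2
      rw [hq'] at hcl
      have hq'nl : ¬ Leak' q' := (hb.mem_outClass_iff hj.hup (arms_subset_of_coreKind hj hζ₀ hk₀)
        (coreBaseOf_agree hζ₀ hk₀) (exists_ext_edge hj hζ₀ hk₀) (ext_out hj hζ₀ hk₀)
        ⟨ed, y, hey, hyA⟩ (Ah_bdry hj ho hζ₀ hk₀) q').1 hcl
      have hq'RB := hq'nl
      rw [leak'_iff, not_or] at hq'RB
      rcases (not_leak'_iff q').1 hq'nl with hC | hE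
      · have := coreKind_mixedReal_core hj hl hζ₀ hk₀ hd₀ hC
        rw [← hq'] at this
        exact hk this.2
      · apply hm
        refine ⟨ζ₀, hζ₀, hk₀, hd₀, ?_, mem_mixedBlock.2 ⟨q', hq'nl, hq'.symm⟩⟩
        rw [hq', hb.baseE_esc hj.hup ⟨ed, y, hey, hyA⟩ (uArms_conn ζ₀) (hAh ζ₀ hζ₀ hk₀)
          (farArms_conn ζ₀) hq'RB.1 hq'RB.2 hE, mixedData_coreBaseOf hj hl hζ₀ hk₀ hd₀]
    exact ⟨hζ'cl, by rw [keyM_of_plain hu' hesc' hm', hall]⟩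

omit ho hAh in
/-- Every block of a `Q`-point satisfies the rigid inequality. -/
theorem card_blockM_le {ζ : Config E} (hζ : ζ ∈ swOutSide ends l h o U ξ) {𝓔 : Set (Set E)}
    (h𝓔 : IsUpperSet 𝓔) :
    ((blockM ends h u p (keyM ends U ξ l h o u p ζ)).filter fun ζ' =>
        ζ' ∈ tgtU ends l h {T : Set V | o ∈ T} ∧ redEdges ends ζ' h ∈ 𝓔).card ≤
      ((blockM ends h u p (keyM ends U ξ l h o u p ζ)).filter fun ζ' =>
        ζ' ∈ tgtU ends l h {T : Set V | o ∈ T} ∧ blueEdges ends ζ' h ∈ 𝓔).card := by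
  by_cases hu : u ∉ hull ends ζ h
  · rw [keyM_of_out hu]
    exact (orbitKind_block hl hj.hloop_h hj.hout hζ hu).2.2 𝓔 h𝓔
  rw [not_not] at hu
  by_cases hk : hull ends ζ u ⊆ U
  · by_cases hd : DeadBlue ends h u p ζ
    · rw [keyM_of_coreMixed hu hk hd]
      exact card_mixedBlock_le hj hl hζ ⟨hu, hk⟩ hd h𝓔
    · rw [keyM_of_coreRed hu hk hd]
      have hb := coreBase_of_coreKind_mix hj hl hζ ⟨hu, hk⟩ (exists_red_dead_of_not_deadBlue hd)
      exact hb.card_coreCube_le (extHull_subset_of_coreKind hζ ⟨hu, hk⟩) hl h𝓔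
  by_cases hm : MixedKindE ends U ξ l h o u p ζ
  · rw [keyM_of_escMixed hu hk hm]
    obtain ⟨ζ₀, hζ₀, hk₀, hd₀, hdata, _⟩ := hm
    show ((mixedBlock ends u p (mixedData ends h u p (baseE ends h u p ζ))).filter _).card ≤
      ((mixedBlock ends u p (mixedData ends h u p (baseE ends h u p ζ))).filter _).card
    rw [← hdata]
    exact card_mixedBlock_le hj hl hζ₀ hk₀ hd₀ h𝓔
  · rw [keyM_of_plain hu hk hm]
    have hc : CoreFree ends ζ h := coreFree_of_escaping hj.hout hζ hk
    exact card_orbit_le (coreFree_allRed hc) hj.hloop_h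
      (allRed_mem_outClass (mem_swOutSide.1 hζ).2 hc) hl h𝓔

/-- **THEOREM A_mix — the rigid inequality on every mixed single-junction class** (every outside
colouring `ξ`): the class is partitioned into coarse orbits, core cubes and mixed blocks. -/
theorem rigidOK_of_mixedJunction : RigidOK ends l h o U ξ :=
  rigidOK_of_blocks ξ (keyM ends U ξ l h o u p) (blockM ends h u p)
    (fun _ hζ => mem_blockM_keyM hj hl hζ)
    (fun _ hζ _ hζ' hQ => keyM_eq_of_mem_blockM hj hl ho hAh hζ hζ' hQ)
    (fun _ hζ _ h𝓔 => card_blockM_le hj hl hζ h𝓔)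

end BigBlock

end Summit.Ventures.PercRepro2
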